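import Mathlib
import Summits.MatrixMultiplication.MatrixMultiplication.Theorems.SnSubsetDichotomyPolynomialSlackLowBlocks
import Summits.MatrixMultiplication.MatrixMultiplication.Theorems.SnSubsetDichotomyPolynomialSlackLevelTwoCharacters
import Summits.MatrixMultiplication.MatrixMultiplication.Theorems.SnSubsetDichotomyPolynomialSlackLevelTwoShapes

/-!
# The four Wedderburn blocks of level `2` of the six-fold TPP convolution in `ℂ[S_n]`

Helper file for the LEVEL-TWO programme on the crux `SnSubsetDichotomy.PolynomialSlack`
(stmt-MatrixMultiplication-8306), companion of `…PolynomialSlackLowBlocks` (the four blocks of level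
`≤ 1`). For `S, T, U ⊆ S_n` write `z = 𝟙_{S⁻¹}𝟙_T · 𝟙_{T⁻¹}𝟙_U · 𝟙_{U⁻¹}𝟙_S ∈ ℂ[S_n]` and, summing
over the six-fold words `w = s⁻¹t·t'⁻¹u·u'⁻¹s'`, `(s,t),(t',u),(u',s') ∈ (S×T)×(T×U)×(U×S)`:
`N = |S||T||U|`, `T₃ = Σ #fix(w)` (fixed points), `P₂ = Σ #{(p,q) : p ≠ q, w p = p, w q = q}`
(ordered pairs of fixed points) and `I_Σ = Σ #{s : #s = 2, w(s) ⊆ s}` (invariant `2`-subsets).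
For a block whose character is `χ^μ` (`stub_blockDictionary`):

* `trace_six_of_twoRowTwo` — `μ = (n-2,2)`: `tr(zᵢ) = I_Σ - T₃`;
* `trace_six_of_twoRowOneOne` — `μ = (n-2,1,1)`: `tr(zᵢ) = P₂ - T₃ + N² - I_Σ`;
* `trace_six_of_twoTwoColumn`, `trace_six_of_threeColumn` — for PARITY-PURE `S, T, U` (each in one
  sign class) the sign twists `μ = (2,2,1^{n-4})`, `(3,1^{n-3})` have the same two traces;
* `degree_of_…` — the dimensions are `C(n,2) - n`, `C(n,2) - n + 1`, `C(n,2) - n`, `C(n,2) - n + 1`;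
* `exists_partition_twoRowTwo/…` — the four partitions exist; `level_two_shapes_nodup` — the eight
  shapes of level `≤ 2` are pairwise distinct; `parts_le_of_not_level_two` — every other partition
  has all parts `≤ n - 3` and at most `n - 3` parts.

References: Blasiak–Cohn–Grochow–Pratt–Umans 2023 (arXiv:2204.03826), proof of Thm. 3.2;
Fulton–Harris GTM 129, Ex. 4.15.
-/

namespace Summit.MatrixMultiplication.MatrixMultiplication.Theorems.PolynomialSlack

open scoped BigOperators Matrix
open Literature.Combinatorics.Additive (TripleProductProperty indicatorElem indicatorElemInv)
open Literature.NumberTheory.DiophantineGeometry (spechtCharacter numStandardTableaux)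
open Literature.RepresentationTheory.FiniteGroups (BlockAlgebraC blockRep character_blockRep_apply)
open Summit.MatrixMultiplication.MatrixMultiplication.Theorems.GlobalBranch
  (blockDictionary_character_blockRep_one stub_blockDictionary)

-- `Summit.<Summit>.<Problem>` is the tree's mandated summit-side namespace (CONVENTIONS §2); for
-- this single-conjunct summit the two coincide, so each declaration silences `dupNamespace`.
set_option linter.dupNamespace false

/-! ## The four partitions of level `2` and the eight shapes of level `≤ 2` -/

/-- The partition `(n-2, 2)` (`n ≥ 4`). [folklore] -/
theorem exists_partition_twoRowTwo {n : ℕ} (hn : 4 ≤ n) :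
    ∃ μ : Nat.Partition n, μ.sortedParts = [n - 2, 2] :=
  exists_partition_sortedParts_eq _ (by simp; omega) (by simp; omega) (by simp; omega)

/-- The partition `(n-2, 1, 1)` (`n ≥ 4`). [folklore] -/
theorem exists_partition_twoRowOneOne {n : ℕ} (hn : 4 ≤ n) :
    ∃ μ : Nat.Partition n, μ.sortedParts = [n - 2, 1, 1] :=
  exists_partition_sortedParts_eq _ (by simp; omega) (by simp; omega) (by simp; omega)

/-- The partition `(2, 2, 1^{n-4})` (`n ≥ 4`). [folklore] -/
theorem exists_partition_twoTwoColumn {n : ℕ} (hn : 4 ≤ n) :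
    ∃ μ : Nat.Partition n, μ.sortedParts = 2 :: 2 :: List.replicate (n - 4) 1 :=
  exists_partition_sortedParts_eq _
    (fun a ha => by
      rcases List.mem_cons.1 ha with rfl | ha
      · exact two_pos
      rcases List.mem_cons.1 ha with rfl | ha
      · exact two_pos
      · rw [List.eq_of_mem_replicate ha]; exact one_pos)
    (List.pairwise_cons.2 ⟨fun b hb => by
        rcases List.mem_cons.1 hb with rfl | hb
        · exact le_rfl
        · rw [List.eq_of_mem_replicate hb]; omega,
      List.pairwise_cons.2 ⟨fun b hb => by rw [List.eq_of_mem_replicate hb]; omega,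
        List.pairwise_replicate.2 (Or.inr le_rfl)⟩⟩)
    (by simp; omega)

/-- The partition `(3, 1^{n-3})` (`n ≥ 3`). [folklore] -/
theorem exists_partition_threeColumn {n : ℕ} (hn : 3 ≤ n) :
    ∃ μ : Nat.Partition n, μ.sortedParts = 3 :: List.replicate (n - 3) 1 :=
  exists_partition_sortedParts_eq _
    (fun a ha => by
      rcases List.mem_cons.1 ha with rfl | ha
      · exact three_pos
      · rw [List.eq_of_mem_replicate ha]; exact one_pos)
    (List.pairwise_cons.2 ⟨fun b hb => by rw [List.eq_of_mem_replicate hb]; omega,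
      List.pairwise_replicate.2 (Or.inr le_rfl)⟩)
    (by simp; omega)

/-- The eight shapes of level `≤ 2` — `(n), (n-1,1), (n-2,2), (n-2,1,1), (1ⁿ), (2,1^{n-2}),
(2,2,1^{n-4}), (3,1^{n-3})` — are pairwise distinct (`n ≥ 7`). [folklore] -/
theorem level_two_shapes_nodup {n : ℕ} (hn : 7 ≤ n) :
    [[n], [n - 1, 1], [n - 2, 2], [n - 2, 1, 1], List.replicate n 1, 2 :: List.replicate (n - 2) 1,
      2 :: 2 :: List.replicate (n - 4) 1, 3 :: List.replicate (n - 3) 1].Nodup := by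
  have h0 : List.replicate n 1 = 1 :: 1 :: 1 :: List.replicate (n - 3) 1 := by
    conv_lhs => rw [show n = (n - 3) + 1 + 1 + 1 by omega]
    rfl
  have h2 : List.replicate (n - 2) 1 = 1 :: List.replicate (n - 3) 1 := by
    conv_lhs => rw [show n - 2 = (n - 3) + 1 by omega]
    rfl
  have h4 : List.replicate (n - 3) 1 = 1 :: List.replicate (n - 4) 1 := by
    conv_lhs => rw [show n - 3 = (n - 4) + 1 by omega]
    rfl
  rw [h0, h2, h4]
  simp [List.eq_replicate_iff]
  omega

/-- A partition of `n ≥ 4` which is none of the eight shapes of level `≤ 2` has all its parts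
`≤ n - 3` and at most `n - 3` parts. [folklore] -/
theorem parts_le_of_not_level_two {n : ℕ} (hn : 4 ≤ n) (μ : Nat.Partition n)
    (h : μ.sortedParts ∉ [[n], [n - 1, 1], [n - 2, 2], [n - 2, 1, 1], List.replicate n 1,
      2 :: List.replicate (n - 2) 1, 2 :: 2 :: List.replicate (n - 4) 1,
      3 :: List.replicate (n - 3) 1]) :
    (∀ a ∈ μ.parts, a + 3 ≤ n) ∧ μ.parts.card + 3 ≤ n := by
  simp only [List.mem_cons, List.not_mem_nil, or_false, not_or] at h
  obtain ⟨h1, h2, h3, h4, h5, h6, h7, h8⟩ := h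
  refine ⟨fun a ha => ?_, ?_⟩
  · by_contra hlt
    rcases sortedParts_of_exists_part_ge_sub_two μ hn ha (by omega) with h | h | h | h
    exacts [h1 h, h2 h, h3 h, h4 h]
  · by_contra hlt
    rcases sortedParts_of_card_parts_ge_sub_two μ hn (by omega) with h | h | h | h
    exacts [h5 h, h6 h, h7 h, h8 h]

/-! ## The character data at the identity -/

section Identity

variable {n : ℕ}

/-- `#fix(1) = n`. [folklore] -/
theorem card_filter_fixed_one :
    (Finset.univ.filter fun p : Fin n => (1 : Equiv.Perm (Fin n)) p = p).card = n := by
  simp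

/-- Every `2`-subset is invariant under `1`: `I₂(1) = C(n,2)`. [folklore] -/
theorem card_filter_invariant_two_one :
    (((Finset.univ : Finset (Fin n)).powersetCard 2).filter
        fun s => ∀ p ∈ s, (1 : Equiv.Perm (Fin n)) p ∈ s).card = n.choose 2 := by
  rw [Finset.filter_true_of_mem fun s _ p hp => by simpa using hp, Finset.card_powersetCard,
    Finset.card_univ, Fintype.card_fin]

/-- The ordered pairs of distinct fixed points of `1`: `F₂(1) = n² - n`. [folklore] -/
theorem card_filter_fixedPairs_one :
    (Finset.univ.filter fun pq : Fin n × Fin n => pq.1 ≠ pq.2 ∧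
        (1 : Equiv.Perm (Fin n)) pq.1 = pq.1 ∧ (1 : Equiv.Perm (Fin n)) pq.2 = pq.2).card =
      n * n - n := by
  have : (Finset.univ.filter fun pq : Fin n × Fin n => pq.1 ≠ pq.2 ∧
      (1 : Equiv.Perm (Fin n)) pq.1 = pq.1 ∧ (1 : Equiv.Perm (Fin n)) pq.2 = pq.2) =
        (Finset.univ : Finset (Fin n)).offDiag := by
    ext pq; simp [Finset.mem_offDiag]
  rw [this, Finset.offDiag_card, Finset.card_univ, Fintype.card_fin]

/-- `n² - n = 2 C(n,2)` in a characteristic-zero field. [folklore] -/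
theorem cast_sq_sub_self_eq {K : Type*} [Field K] [CharZero K] (n : ℕ) :
    ((n * n - n : ℕ) : K) = 2 * (n.choose 2 : K) := by
  rw [Nat.cast_choose_two, Nat.cast_sub (Nat.le_mul_self n)]
  push_cast
  ring

end Identity

/-! ## The four blocks of level `2` evaluated -/

section LevelTwoBlocks

/-- The block of `(n-2, 2)`: `tr(zᵢ) = I_Σ - T₃`. [folklore] -/
theorem trace_six_of_twoRowTwo {n r : ℕ} {d : Fin r → ℕ} (φ : MonoidAlgebra ℂ (Equiv.Perm (Fin n)) ≃ₐ[ℂ] BlockAlgebraC d) (part : Fin r → Nat.Partition n) (hchar : ∀ i, (blockRep φ i).character = spechtCharacter ℂ (part i)) (S T U : Finset (Equiv.Perm (Fin n))) (hn : 4 ≤ n) {i : Fin r} (h : (part i).sortedParts = [n - 2, 2]) : Matrix.trace (φ ((indicatorElemInv ℂ S * indicatorElem ℂ T) * (indicatorElemInv ℂ T * indicatorElem ℂ U) * (indicatorElemInv ℂ U * indicatorElem ℂ S)) i) = ((∑ y ∈ ((S ×ˢ T) ×ˢ (T ×ˢ U)) ×ˢ (U ×ˢ S), ((Finset.powersetCard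 2 (Finset.univ : Finset (Fin n))).filter fun s => ∀ p ∈ s, (y.1.1.1⁻¹ * y.1.1.2 * (y.1.2.1⁻¹ * y.1.2.2) * (y.2.1⁻¹ * y.2.2)) p ∈ s).card : ℕ) : ℂ) - ((∑ y ∈ ((S ×ˢ T) ×ˢ (T ×ˢ U)) ×ˢ (U ×ˢ S), (Finset.univ.filter fun p : Fin n => (y.1.1.1⁻¹ * y.1.1.2 * (y.1.2.1⁻¹ * y.1.2.2) * (y.2.1⁻¹ * y.2.2)) p = p).card : ℕ) : ℂ) := by
  rw [trace_block_six, hchar i]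
  simp only [spechtCharacter_of_sortedParts_eq_twoRowTwo (part i) hn h, Finset.sum_sub_distrib,
    Nat.cast_sum]

/-- The block of `(n-2, 1, 1)`: `tr(zᵢ) = P₂ - T₃ + N² - I_Σ`. [folklore] -/
theorem trace_six_of_twoRowOneOne {n r : ℕ} {d : Fin r → ℕ} (φ : MonoidAlgebra ℂ (Equiv.Perm (Fin n)) ≃ₐ[ℂ] BlockAlgebraC d) (part : Fin r → Nat.Partition n) (hchar : ∀ i, (blockRep φ i).character = spechtCharacter ℂ (part i)) (S T U : Finset (Equiv.Perm (Fin n))) (hn : 4 ≤ n) {i : Fin r} (h : (part i).sortedParts = [n - 2, 1, 1]) : Matrix.trace (φ ((indicatorElemInv ℂ S * indicatorElem ℂ T) * (indicatorElemInv ℂ T * indicatorElem ℂ U) * (indicatorElemInv ℂ U * indicatorElem ℂ S)) i) = ((∑ y ∈ ((S ×ˢ T) ×ˢ (T ×ˢ U)) ×ˢ (U ×ˢ S), (Finset.univ.filter fun pq : Fin n × Fin n => pq.1 ≠ pq.2 ∧ (y.1.1.1⁻¹ * y.1.1.2 * (y.1.2.1⁻¹ * y.1.2.2) * (y.2.1⁻¹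 * y.2.2)) pq.1 = pq.1 ∧ (y.1.1.1⁻¹ * y.1.1.2 * (y.1.2.1⁻¹ * y.1.2.2) * (y.2.1⁻¹ * y.2.2)) pq.2 = pq.2).card : ℕ) : ℂ) - ((∑ y ∈ ((S ×ˢ T) ×ˢ (T ×ˢ U)) ×ˢ (U ×ˢ S), (Finset.univ.filter fun p : Fin n => (y.1.1.1⁻¹ * y.1.1.2 * (y.1.2.1⁻¹ * y.1.2.2) * (y.2.1⁻¹ * y.2.2)) p = p).card : ℕ) : ℂ) + (((S.card * T.card * U.card) ^ 2 : ℕ) : ℂ) - ((∑ y ∈ ((S ×ˢ T) ×ˢ (T ×ˢ U)) ×ˢ (U ×ˢ S), ((Finset.powersetCard 2 (Finset.univ : Finset (Fin n))).filter fun s => ∀ p ∈ s, (y.1.1.1⁻¹ * y.1.1.2 * (y.1.2.1⁻¹ * y.1.2.2) * (y.2.1⁻¹ * y.2.2)) p ∈ s).card : ℕ) : ℂ) := by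
  rw [trace_block_six, hchar i]
  simp only [spechtCharacter_of_sortedParts_eq_twoRowOneOne (part i) hn h, Finset.sum_sub_distrib,
    Finset.sum_add_distrib, Finset.sum_const, nsmul_eq_mul, mul_one, card_six, Nat.cast_sum]

/-- The block of `(2, 2, 1^{n-4})`, parity-pure sets: `tr(zᵢ) = I_Σ - T₃`. [folklore] -/
theorem trace_six_of_twoTwoColumn {n r : ℕ} {d : Fin r → ℕ} (φ : MonoidAlgebra ℂ (Equiv.Perm (Fin n)) ≃ₐ[ℂ] BlockAlgebraC d) (part : Fin r → Nat.Partition n) (hchar : ∀ i, (blockRep φ i).character = spechtCharacter ℂ (part i)) (S T U : Finset (Equiv.Perm (Fin n))) (hS : ∀ s ∈ S, ∀ s' ∈ S, Equiv.Perm.sign s = Equiv.Perm.sign s') (hT : ∀ t ∈ T, ∀ t' ∈ T, Equiv.Perm.sign t = Equiv.Perm.sign t') (hU : ∀ u ∈ U, ∀ u' ∈ U, Equiv.Perm.sign u = Equiv.Perm.sign u') (hn : 4 ≤ n) {i : Fin r} (h : (part i).sortedParts = 2 :: 2 :: List.replicate (n - 4) 1) : Matrix.trace (φ ((indicatorElemInv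 ℂ S * indicatorElem ℂ T) * (indicatorElemInv ℂ T * indicatorElem ℂ U) * (indicatorElemInv ℂ U * indicatorElem ℂ S)) i) = ((∑ y ∈ ((S ×ˢ T) ×ˢ (T ×ˢ U)) ×ˢ (U ×ˢ S), ((Finset.powersetCard 2 (Finset.univ : Finset (Fin n))).filter fun s => ∀ p ∈ s, (y.1.1.1⁻¹ * y.1.1.2 * (y.1.2.1⁻¹ * y.1.2.2) * (y.2.1⁻¹ * y.2.2)) p ∈ s).card : ℕ) : ℂ) - ((∑ y ∈ ((S ×ˢ T) ×ˢ (T ×ˢ U)) ×ˢ (U ×ˢ S), (Finset.univ.filter fun p : Fin n => (y.1.1.1⁻¹ * y.1.1.2 * (y.1.2.1⁻¹ * y.1.2.2) * (y.2.1⁻¹ * y.2.2)) p = p).card : ℕ) : ℂ) := by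
  rw [trace_block_six, hchar i]
  rw [Finset.sum_congr rfl fun y hy => by
    rw [spechtCharacter_of_transpose_sortedParts_eq_twoRowTwo (part i) hn
      (sortedParts_transpose_of_eq_twoTwoColumn (part i) hn h), sign_six_eq_one hS hT hU hy]]
  simp only [Units.val_one, Int.cast_one, one_mul, Finset.sum_sub_distrib, Nat.cast_sum]

/-- The block of `(3, 1^{n-3})`, parity-pure sets: `tr(zᵢ) = P₂ - T₃ + N² - I_Σ`. [folklore] -/
theorem trace_six_of_threeColumn {n r : ℕ} {d : Fin r → ℕ} (φ : MonoidAlgebra ℂ (Equiv.Perm (Fin n)) ≃ₐ[ℂ] BlockAlgebraC d) (part : Fin r → Nat.Partition n) (hchar : ∀ i, (blockRep φ i).character = spechtCharacter ℂ (part i)) (S T U : Finset (Equiv.Perm (Fin n))) (hS : ∀ s ∈ S, ∀ s' ∈ S, Equiv.Perm.sign s = Equiv.Perm.sign s') (hT : ∀ t ∈ T, ∀ t' ∈ T, Equiv.Perm.sign t = Equiv.Perm.sign t') (hU : ∀ u ∈ U, ∀ u' ∈ U, Equiv.Perm.sign u = Equiv.Perm.sign u') (hn : 4 ≤ n) {i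 : Fin r} (h : (part i).sortedParts = 3 :: List.replicate (n - 3) 1) : Matrix.trace (φ ((indicatorElemInv ℂ S * indicatorElem ℂ T) * (indicatorElemInv ℂ T * indicatorElem ℂ U) * (indicatorElemInv ℂ U * indicatorElem ℂ S)) i) = ((∑ y ∈ ((S ×ˢ T) ×ˢ (T ×ˢ U)) ×ˢ (U ×ˢ S), (Finset.univ.filter fun pq : Fin n × Fin n => pq.1 ≠ pq.2 ∧ (y.1.1.1⁻¹ * y.1.1.2 * (y.1.2.1⁻¹ * y.1.2.2) * (y.2.1⁻¹ * y.2.2)) pq.1 = pq.1 ∧ (y.1.1.1⁻¹ * y.1.1.2 * (y.1.2.1⁻¹ * y.1.2.2) * (y.2.1⁻¹ * y.2.2)) pq.2 = pq.2).card : ℕ) : ℂ) - ((∑ y ∈ ((S ×ˢ T) ×ˢ (T ×ˢ U)) ×ˢ (U ×ˢ S), (Finset.univ.filter fun p : Fin n => (y.1.1.1⁻¹ * y.1.1.2 * (y.1.2.1⁻¹ * y.1.2.2) * (y.2.1⁻¹ * y.2.2)) p = p).card : ℕ) : ℂ) + (((S.card * T.card * U.card) ^ 2 : ℕ) : ℂ)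 - ((∑ y ∈ ((S ×ˢ T) ×ˢ (T ×ˢ U)) ×ˢ (U ×ˢ S), ((Finset.powersetCard 2 (Finset.univ : Finset (Fin n))).filter fun s => ∀ p ∈ s, (y.1.1.1⁻¹ * y.1.1.2 * (y.1.2.1⁻¹ * y.1.2.2) * (y.2.1⁻¹ * y.2.2)) p ∈ s).card : ℕ) : ℂ) := by
  rw [trace_block_six, hchar i]
  rw [Finset.sum_congr rfl fun y hy => by
    rw [spechtCharacter_of_transpose_sortedParts_eq_twoRowOneOne (part i) hn
      (sortedParts_transpose_of_eq_threeColumn (part i) hn h), sign_six_eq_one hS hT hU hy]]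
  simp only [Units.val_one, Int.cast_one, one_mul, Finset.sum_sub_distrib, Finset.sum_add_distrib,
    Finset.sum_const, nsmul_eq_mul, mul_one, card_six, Nat.cast_sum]

/-! ### The four dimensions -/

/-- The block of `(n-2, 2)` has dimension `C(n,2) - n`. [folklore] -/
theorem degree_of_twoRowTwo {n r : ℕ} {d : Fin r → ℕ} (φ : MonoidAlgebra ℂ (Equiv.Perm (Fin n)) ≃ₐ[ℂ] BlockAlgebraC d) (part : Fin r → Nat.Partition n) (hchar : ∀ i, (blockRep φ i).character = spechtCharacter ℂ (part i)) (hn : 4 ≤ n) {i : Fin r} (h : (part i).sortedParts = [n - 2, 2]) : (d i : ℝ) = ((n.choose 2 : ℕ) : ℝ) - n := by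
  have h1 := blockDictionary_character_blockRep_one φ i
  rw [hchar i, spechtCharacter_of_sortedParts_eq_twoRowTwo (part i) hn h,
    card_filter_invariant_two_one, card_filter_fixed_one] at h1
  have h2 : ((d i : ℝ) : ℂ) = ((((n.choose 2 : ℕ) : ℝ) - n : ℝ) : ℂ) := by
    push_cast; exact h1.symm
  exact_mod_cast h2

/-- The block of `(n-2, 1, 1)` has dimension `C(n,2) - n + 1`. [folklore] -/
theorem degree_of_twoRowOneOne {n r : ℕ} {d : Fin r → ℕ} (φ : MonoidAlgebra ℂ (Equiv.Perm (Fin n)) ≃ₐ[ℂ] BlockAlgebraC d) (part : Fin r → Nat.Partition n) (hchar : ∀ i, (blockRep φ i).character = spechtCharacter ℂ (part i)) (hn : 4 ≤ n) {i : Fin r} (h : (part i).sortedParts = [n - 2, 1, 1]) : (d i : ℝ) = ((n.choose 2 : ℕ) : ℝ) - n + 1 := by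
  have h1 := blockDictionary_character_blockRep_one φ i
  rw [hchar i, spechtCharacter_of_sortedParts_eq_twoRowOneOne (part i) hn h,
    card_filter_fixedPairs_one, card_filter_invariant_two_one, card_filter_fixed_one,
    cast_sq_sub_self_eq] at h1
  have h2 : ((d i : ℝ) : ℂ) = ((((n.choose 2 : ℕ) : ℝ) - n + 1 : ℝ) : ℂ) := by
    push_cast; rw [← h1]; ring
  exact_mod_cast h2

/-- The block of `(2, 2, 1^{n-4})` has dimension `C(n,2) - n`. [folklore] -/
theorem degree_of_twoTwoColumn {n r : ℕ} {d : Fin r → ℕ} (φ : MonoidAlgebra ℂ (Equiv.Perm (Fin n)) ≃ₐ[ℂ] BlockAlgebraC d) (part : Fin r → Nat.Partition n) (hchar : ∀ i, (blockRep φ i).character = spechtCharacter ℂ (part i)) (hn : 4 ≤ n) {i : Fin r} (h : (part i).sortedParts = 2 :: 2 :: List.replicate (n - 4) 1) : (d i : ℝ) = ((n.choose 2 : ℕ) : ℝ) - n := by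
  have h1 := blockDictionary_character_blockRep_one φ i
  rw [hchar i, spechtCharacter_of_transpose_sortedParts_eq_twoRowTwo (part i) hn
    (sortedParts_transpose_of_eq_twoTwoColumn (part i) hn h), Equiv.Perm.sign_one, Units.val_one,
    Int.cast_one, one_mul, card_filter_invariant_two_one, card_filter_fixed_one] at h1
  have h2 : ((d i : ℝ) : ℂ) = ((((n.choose 2 : ℕ) : ℝ) - n : ℝ) : ℂ) := by
    push_cast; exact h1.symm
  exact_mod_cast h2

/-- The block of `(3, 1^{n-3})` has dimension `C(n,2) - n + 1`. [folklore] -/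
theorem degree_of_threeColumn {n r : ℕ} {d : Fin r → ℕ} (φ : MonoidAlgebra ℂ (Equiv.Perm (Fin n)) ≃ₐ[ℂ] BlockAlgebraC d) (part : Fin r → Nat.Partition n) (hchar : ∀ i, (blockRep φ i).character = spechtCharacter ℂ (part i)) (hn : 4 ≤ n) {i : Fin r} (h : (part i).sortedParts = 3 :: List.replicate (n - 3) 1) : (d i : ℝ) = ((n.choose 2 : ℕ) : ℝ) - n + 1 := by
  have h1 := blockDictionary_character_blockRep_one φ i
  rw [hchar i, spechtCharacter_of_transpose_sortedParts_eq_twoRowOneOne (part i) hn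
    (sortedParts_transpose_of_eq_threeColumn (part i) hn h), Equiv.Perm.sign_one, Units.val_one,
    Int.cast_one, one_mul, card_filter_fixedPairs_one, card_filter_invariant_two_one,
    card_filter_fixed_one, cast_sq_sub_self_eq] at h1
  have h2 : ((d i : ℝ) : ℂ) = ((((n.choose 2 : ℕ) : ℝ) - n + 1 : ℝ) : ℂ) := by
    push_cast; rw [← h1]; ring
  exact_mod_cast h2

end LevelTwoBlocks

end Summit.MatrixMultiplication.MatrixMultiplication.Theorems.PolynomialSlack
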